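import Summits.QuantumFields.BalabanUV.Beta.GAN24.TaylorRowDW
import Summits.QuantumFields.BalabanUV.Beta.GAN24.FineReadoutCauchyDecThree

/-!
# `BalabanUV.Beta.GAN24.TaylorRowDWThree` — binder row G-an2-4 ∕ (CONV-C), S-slot, road «S3-Taylor»: **THE DIFF ROW R3-dW OF THE
# RATE TABLE «E3SupRate» IS A TREE THEOREM, UNCONDITIONAL AT `d = 3`, `Lc ≥ 2`** (`rowDW_three`)

G-an2-4 formalisation swarm, leaf prover 15 (unit `b2b-balaban-gan24-formalise-leaf-15`, gen 14; DIFF row R3-dW holder — LEAVES.md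
PART III § III.R, INTENT CLAIMS.log l.4908).  NOT IN PRINT; OUR PROOF.  HONEST FRAMING (cell rule, verbatim): «discharging `BetaPertH`
makes Bałaban's UV stability UNCONDITIONAL — a real constructive-QFT result; it is NOT the continuum limit and NOT the Clay problem.»
HONEST DEPENDENCY (verbatim): «continuum YM on T⁴ ⇐ BetaPertH ∧ nine spine estimates (0/9 proved); BetaPertH ⇐ (D1) ∧ (D4) ∧
CAP+tail; G-an2-4 gates asym, D1 and NE2/3/4.»  [folklore] two-line composition of TREE theorems BY NAME: the conditional row
`TaylorRowDW.rowDW_of_cauchy` (this lineage; (N1) ∧ (N1′) inside by name) and the now UNCONDITIONAL pointwise-sample one-step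
convergence of the normalised minimiser column `FineReadoutCauchyDecThree.blockSample_cauchy_three` (leaf-19's adapter over
leaf-17's `FineReadoutCauchyHolds` = T-N1C «(N1-Cauchy)», itself over leaf-16's PART A and leaf-13's real-zone rate).  No cited fact,
no `def`, no hypothesis beyond `2 ≤ Lc`.  ONE of twelve analytic rows of the S-slot tables; discharges NOTHING of (hS, hSall) ∕
«E3SupRate» by itself (the owner's countdown `StencilSlotSAllThree` consumes dW ∧ dV ∧ dL); NOT BetaPertH, NOT continuum, NOT Clay.
-/

noncomputable section

open Literature.MathematicalPhysics.QuantumFieldTheory Balaban1983to89 Balaban1983to89.Beta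
open StepJetData (wilsonA)
open Summit.QuantumFields.BalabanUV.Beta.GAN24.E3UnitSplit (e3OfS)
open Summit.QuantumFields.BalabanUV.Beta.GAN24.CombesThomas (SupBound)

namespace Summit.QuantumFields.BalabanUV.Beta.GAN24.TaylorRowDWThree

/-- NOT IN PRINT; OUR PROOF.  **ROW R3-dW OF THE RATE TABLE AT `d = 3`, UNCONDITIONALLY** (LEAVES.md PART III § III.R; the hypothesis
`dW` of the row owner's RATE END `StencilSlotE3RateOfPieces.e3SupRate_of_pieces` — equivalently the `dW` binder of
`StencilSlotRowsMerge.hS_hSall_of_rows_indep` (l.278) and of the countdown `StencilSlotSAllThree.hS_hSall_three_of_diffRows` — VERBATIM at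
`d = 3`, delivered as `∃ eW θ, 0 ≤ θ ∧ θ < 1 ∧ ∀ n κ′ u′, SupBound (…) (eW·θ^(n+1))`): for every blocking factor `Lc ≥ 2` and every
Wilson coefficient `cE`, the DEPTH-PAIRED ONE-STEP DIFFERENCE of the Wilson pieces of the normalised third jet of Bałaban's `U = 1`
block-spin step — member `n+3` (blocking `Lc^{n+3}`, table weight `cE·(Lc⁴)^{n+2}`) minus member `n+2` — is bounded in sup norm by
`eW·θ^{n+1}` with ONE ratio `θ < 1` and ONE constant `eW`, both free of `n`.  Proof: `TaylorRowDW.rowDW_of_cauchy` (the two-level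
engine `TaylorTrilinearDiff.trilinear_diff_bound` instantiated at `E3UnitSplit.e3W_unit_split`, (N1) ∧ (N1′) by name) fed with
`FineReadoutCauchyDecThree.blockSample_cauchy_three` («(N1-Cauchy)» in the pointwise-sample block-label `ℓ¹` currency, by name).
Constants: `θ = max θ′ Lc⁻¹`, `eW = |cE/Lc⁴|·4³·81²·wBound 3·Zl 4 (δ/2)·(c′·X_I + X_II/Lc)` at the common rate `δ = min (κ₀/4) κ′` of
`exists_wH_decay_and_grad` and `blockSample_cauchy_three`.  ONE of twelve analytic rows; discharges NOTHING of (hS, hSall) by itself;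
NOT BetaPertH, NOT continuum, NOT Clay. -/
theorem rowDW_three {Lc : ℕ} [NeZero Lc] (hLc : 2 ≤ Lc) (cE : ℝ) :
    ∃ eW θ : ℝ, 0 ≤ θ ∧ θ < 1 ∧ ∀ (n : ℕ) (κ' : Fin (3 + 1)) (u' : Fin (3 + 1) → ℤ), SupBound (fun x z a b =>
      ((Lc : ℝ) ^ (n + 1 + 1 + 1)) ^ (2 * (3 + 1)) * e3OfS (Lc ^ (n + 1 + 1 + 1))
          (fun κ u => (cE * ((Lc : ℝ) ^ (3 + 1)) ^ (n + 1 + 1)) • wilsonA 3 κ u) κ' u' x z a b -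
        ((Lc : ℝ) ^ (n + 1 + 1)) ^ (2 * (3 + 1)) * e3OfS (Lc ^ (n + 1 + 1))
          (fun κ u => (cE * ((Lc : ℝ) ^ (3 + 1)) ^ (n + 1)) • wilsonA 3 κ u) κ' u' x z a b) (eW * θ ^ (n + 1)) := by
  obtain ⟨cC, θC, δC, hcC, hθC0, hθC1, hδC, hNC⟩ := FineReadoutCauchyDecThree.blockSample_cauchy_three (Lc := Lc) hLc
  exact TaylorRowDW.rowDW_of_cauchy hLc cE hδC hcC hθC0 hθC1 hNC

end Summit.QuantumFields.BalabanUV.Beta.GAN24.TaylorRowDWThree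

end
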